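import Literature.Analysis.FluidPDE.PassiveScalarDiagEnergy
import HarnessLib

/-!
# Energy equality for weak passive scalars with constant diagonal diffusion, bounded drift and
# an `L¹_t L²_x` source — and its isotropic corollaries

Analysis/FluidPDE file (everything proved; no definitions, no named facts). Main results, for
`κ > 0`, positive diagonal coefficients `a : d → ℝ`, `θ₀ ∈ L²(T^d)`, a drift `u ∈ L^∞((0,T) × T^d)`
(weakly divergence free for a.e. `t` — part of the class) and a source with
`∫₀ᵀ ‖s(t)‖_{L²} dt < ∞`, for EVERY weak solution `θ ∈ L^∞_t L²_x` of
`∂ₜθ + u·∇θ = κ ∑ᵢ aᵢ ∂ᵢ∂ᵢθ + s` on `T^d × [0,T)` (`Torus.IsWeakScalarTransportDiagForcedOn`, the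
DiPerna–Lions class with the constant diagonal diffusion of a rectangular flat torus written on
the unit torus, Hess-Childs–Rowan 2025, App. A):

* `IsWeakScalarTransportDiagForcedOn.energy_eq` — **energy EQUALITY** for a.e. `t ∈ (0,T)`:
  `‖θ(t)‖²_{L²} + 2κ ∫₀ᵗ ‖∇θ‖²_a = ‖θ₀‖²_{L²} + 2∫₀ᵗ ∫ s θ`, `‖∇θ‖²_a = Torus.eScalarGradNormSqDiag a θ`
  (Bonicatto–Ciampa–Crippa 2024, Thm. 3.3, (3.4), Remark 3.4 — "the energy balance holds as an
  equality" — at the corner `p = ∞`, `q = 2`, with a source term, DEIJ 2022 (1.1)–(1.2));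
* `…aemeasurable_eScalarGradNormSqDiag`, `…integrableOn_toReal_eScalarGradNormSqDiag` (the real
  `A`-dissipation is integrable on `(0,T)`: `L²_t H¹_x`, with `…lintegral_eScalarGradNormSqDiag_lt_top`
  of `PassiveScalarDiagEnergy`), `…two_mul_dissipation_le`
  (`2κ∫₀ᵀ‖∇θ‖²_a ≤ ‖θ₀‖² + 2∫₀ᵀ|∫ s θ|`);
* the homogeneous diagonal class: `IsWeakScalarTransportDiagOn.lintegral_sq_add_eq` (`ℝ≥0∞` form,
  `‖θ(t)‖² + 2κ∫₀ᵗ‖∇θ‖²_a = ‖θ₀‖²` a.e.) and `IsWeakScalarTransportDiagOn.energy_ineq`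
  (`2κ ∫₀ᵀ ‖∇θ‖²_a ≤ ‖θ₀‖²`);
* the ISOTROPIC corollaries (`a ≡ 1`, `Torus.isWeakScalarTransportDiag(Forced)On_one_iff`,
  `Torus.eScalarGradNormSqDiag_one`): `IsWeakScalarTransportForcedOn.energy_eq`,
  `IsWeakScalarTransportForcedOn.lintegral_eScalarGradNormSq_lt_top` (forced, bounded drift — not
  previously in the tree) and `IsWeakScalarTransportOn.lintegral_sq_add_eq`, the `=`-form of
  `IsWeakScalarTransportOn.lintegral_sq_add_le_holds` (`PassiveScalarEnergyPointwise`).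

Proof (files `PassiveScalarDiagGalerkin`, `…GalerkinIdentity`, `…GalerkinBounds`, `…Energy`):
Fourier–Galerkin on the given weak solution — truncated identity, first pass (Young) for a
uniform bound on the truncated `A`-dissipation, monotone convergence, second pass
(Cauchy–Schwarz in space and time) for the vanishing of the transport remainder, Parseval tails
and dominated convergence for the energy and source terms.

## References

* P. Bonicatto, G. Ciampa, G. Crippa, *Weak and parabolic solutions of advection–diffusion
  equations with rough velocity field*, J. Evol. Equ. 24 (2024), Paper No. 1 (arXiv:2306.15529),
  Thm. 3.3, (3.4), Remark 3.4, Cor. 3.5. [`BonicattoCiampaCrippa2023`]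
* T. D. Drivas, T. M. Elgindi, G. Iyer, I.-J. Jeong, ARMA 243 (2022), (1.1)–(1.3). [`DEIJ2022`]
* E. Hess-Childs, K. Rowan, arXiv:2501.18526 (2025), Def. 2.2, App. A. [`HessChildsRowan2025a`]
* J. C. Robinson, J. L. Rodrigo, W. Sadowski, *The three-dimensional Navier–Stokes equations*
  (CUP 2016), §4.1–4.2. [`RobinsonRodrigoSadowski2016`]
-/

noncomputable section

open _root_.MeasureTheory _root_.Set _root_.Filter _root_.Function _root_.TopologicalSpace
open scoped ENNReal NNReal InnerProductSpace ContDiff Topology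
open Literature.Analysis.FunctionSpaces.Torus Literature.Analysis.FunctionSpaces UnitAddTorus

namespace Literature.Analysis.FluidPDE

variable {d : Type*} [Fintype d] [DecidableEq d]

namespace Torus

namespace IsWeakScalarTransportDiagForcedOn

variable {T κ : ℝ} {a : d → ℝ} {u : ℝ → UnitAddTorus d → EuclideanSpace ℝ d} {s : ℝ → UnitAddTorus d → ℝ}
  {θ₀ : UnitAddTorus d → ℝ} {θ : ℝ → UnitAddTorus d → ℝ}

/-! ## The energy equality -/

/-- **Energy equality for weak passive scalars with constant diagonal diffusion, bounded drift
and an `L¹_t L²_x` source.** For `κ > 0`, `aᵢ > 0`, `θ₀ ∈ L²(T^d)`, `u ∈ L^∞((0,T) × T^d)`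
(weakly divergence free for a.e. `t`, part of the class) and `∫₀ᵀ ‖s(t)‖_{L²} dt < ∞`, EVERY weak
solution `θ ∈ L^∞_t L²_x` of `∂ₜθ + u·∇θ = κ ∑ᵢ aᵢ ∂ᵢ∂ᵢθ + s` on `T^d × [0,T)`
(`Torus.IsWeakScalarTransportDiagForcedOn`) satisfies, for a.e. `t ∈ (0,T)`,
`‖θ(t)‖²_{L²} + 2κ ∫₀ᵗ ‖∇θ(τ)‖²_a dτ = ‖θ₀‖²_{L²} + 2 ∫₀ᵗ ∫ s θ`,
with the `A`-weighted dissipation `‖∇θ‖²_a = Torus.eScalarGradNormSqDiag a θ = ∑ᵢ aᵢ ‖∂ᵢθ‖²` (finite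
in time integral by `lintegral_eScalarGradNormSqDiag_lt_top`). This is Bonicatto–Ciampa–Crippa 2024,
Thm. 3.3, (3.4) and Remark 3.4 (the energy balance of distributional solutions in
`L^∞_t L^q_x` with `b ∈ L²_t L^p_x`, `1/p + 1/q ≤ 1/2`, holds AS AN EQUALITY) at the corner
`p = ∞, q = 2`, for the constant diagonal diffusion (the isotropic equation of a rectangular flat
torus in unit-torus coordinates, Hess-Childs–Rowan 2025, App. A) and with a source term
(DEIJ 2022, (1.1)–(1.2)). Proof: Fourier–Galerkin instead of mollification — the truncated identity
`PassiveScalarDiagGalerkin.ae_galerkin_energy_eq`, the first-pass bound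
`exists_integral_galerkin_diss_le`, monotone convergence of the truncated dissipations and the
vanishing of the transport remainder `tendsto_integral_galerkin_remainder`.
[cite: BonicattoCiampaCrippa2023, Thm. 3.3, (3.4) and Remark 3.4] -/
theorem energy_eq (h : IsWeakScalarTransportDiagForcedOn T a κ u s θ₀ θ)
    (hκ : 0 < κ) (ha : ∀ i, 0 < a i) (hθ₀ : MemLp θ₀ 2 volume)
    (hu : MemLp (stLift u) ⊤ (volume.restrict (Ioo 0 T ×ˢ univ)))
    (hs : ∫⁻ t in Ioo 0 T, (∫⁻ x, ‖s t x‖ₑ ^ 2) ^ (1 / 2 : ℝ) < ⊤) :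
    ∀ᵐ t ∂(volume.restrict (Ioo 0 T)),
      (∫ x, θ t x ^ 2) + 2 * κ * (∫⁻ τ in Ioo 0 t, Torus.eScalarGradNormSqDiag a (θ τ)).toReal =
        (∫ x, θ₀ x ^ 2) + 2 * ∫ τ in Ioo 0 t, ∫ x, s τ x * θ τ x := by
  have hθ₀i : Integrable θ₀ volume := hθ₀.integrable one_le_two
  have ha' : ∀ i, 0 ≤ a i := fun i => (ha i).le
  filter_upwards [h.ae_galerkin_energy_eq_remainder hθ₀i hu, h.ae_memLp_two, ae_restrict_mem measurableSet_Ioo]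
    with t ht hmt htT
  -- the five sequences
  set EN : ℕ → ℝ := fun N => ∑ k ∈ freqBall N, ‖mFourierCoeff (fun x => (θ t x : ℂ)) k‖ ^ 2 with hEN
  set E0 : ℕ → ℝ := fun N => ∑ k ∈ freqBall N, ‖mFourierCoeff (fun x => (θ₀ x : ℂ)) k‖ ^ 2 with hE0
  set XN : ℕ → ℝ := fun N => ∫ τ in Ioc 0 t, 4 * Real.pi ^ 2 * ∑ k ∈ freqBall N,
    Torus.diagSymbol a k * ‖mFourierCoeff (fun x => (θ τ x : ℂ)) k‖ ^ 2 with hXN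
  set RN : ℕ → ℝ := fun N => ∫ τ in Ioc 0 t, ∫ x, (θ τ x - scalarTruncate N (θ τ) x) *
    ⟪u τ x, gradient (scalarTruncate N (θ τ)) x⟫_ℝ with hRN
  set SN : ℕ → ℝ := fun N => ∫ τ in Ioc 0 t, ∫ x, s τ x * scalarTruncate N (θ τ) x with hSN
  have hid : ∀ N, EN N = E0 N + 2 * RN N - 2 * κ * XN N + 2 * SN N := ht
  -- their limits
  have hENl : Tendsto EN atTop (𝓝 (∫ x, θ t x ^ 2)) :=
    (hasSum_sq_norm_mFourierCoeff_ofReal hmt).comp tendsto_freqBall_atTop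
  have hE0l : Tendsto E0 atTop (𝓝 (∫ x, θ₀ x ^ 2)) :=
    (hasSum_sq_norm_mFourierCoeff_ofReal hθ₀).comp tendsto_freqBall_atTop
  have hSNl : Tendsto SN atTop (𝓝 (∫ τ in Ioc 0 t, ∫ x, s τ x * θ τ x)) :=
    h.tendsto_integral_galerkin_source hs htT.2
  have hRNl : Tendsto RN atTop (𝓝 0) := h.tendsto_integral_galerkin_remainder hκ ha hθ₀ hu hs htT.2
  set L : ℝ := ((∫ x, θ₀ x ^ 2) + 2 * (∫ τ in Ioc 0 t, ∫ x, s τ x * θ τ x) - ∫ x, θ t x ^ 2) / (2 * κ) with hL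
  have hXNl : Tendsto XN atTop (𝓝 L) := by
    have e : XN = fun N => (E0 N + 2 * RN N + 2 * SN N - EN N) / (2 * κ) := by
      funext N
      have := hid N
      field_simp
      linarith
    rw [e, hL]
    have h1 := ((hE0l.add ((hRNl.const_mul 2).add (hSNl.const_mul 2))).sub hENl).div_const (2 * κ)
    have h2 : Tendsto (fun N => (E0 N + 2 * RN N + 2 * SN N - EN N) / (2 * κ)) atTop
        (𝓝 (((∫ x, θ₀ x ^ 2) + (2 * 0 + 2 * ∫ τ in Ioc 0 t, ∫ x, s τ x * θ τ x) - ∫ x, θ t x ^ 2) / (2 * κ))) :=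
      h1.congr' (Eventually.of_forall fun N => by ring)
    convert h2 using 3
    ring
  -- the truncated dissipations increase to the `A`-dissipation
  have hXmono : Monotone XN := by
    refine monotone_nat_of_le_succ fun N => ?_
    have hsub : Ioc 0 t ⊆ Ioo 0 T := Ioc_subset_Ioo_right htT.2
    refine integral_mono_ae ((h.integrableOn_galerkin_diss N).mono_set hsub)
      ((h.integrableOn_galerkin_diss (N + 1)).mono_set hsub) (Eventually.of_forall fun τ => ?_)
    exact mul_le_mul_of_nonneg_left (Finset.sum_le_sum_of_subset_of_nonneg (freqBall_mono (Nat.le_succ N))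
      fun k _ _ => mul_nonneg (Torus.diagSymbol_nonneg ha' k) (sq_nonneg _)) (by positivity)
  have hL0 : 0 ≤ L := by
    refine ge_of_tendsto' hXNl fun N => ?_
    exact setIntegral_nonneg measurableSet_Ioc fun τ _ => mul_nonneg (by positivity)
      (Finset.sum_nonneg fun k _ => mul_nonneg (Torus.diagSymbol_nonneg ha' k) (sq_nonneg _))
  have hlin : (∫⁻ τ in Ioo 0 t, Torus.eScalarGradNormSqDiag a (θ τ)).toReal = L := by
    rw [h.lintegral_eScalarGradNormSqDiag_eq_iSup ha' htT.2.le]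
    have e : ∀ N, ENNReal.ofReal (∫ τ in Ioo 0 t, 4 * Real.pi ^ 2 * ∑ k ∈ freqBall N,
        Torus.diagSymbol a k * ‖mFourierCoeff (fun x => (θ τ x : ℂ)) k‖ ^ 2) = ENNReal.ofReal (XN N) := by
      intro N
      rw [hXN, setIntegral_congr_set Ioo_ae_eq_Ioc]
    simp_rw [e]
    have hsup : ⨆ N, ENNReal.ofReal (XN N) = ENNReal.ofReal L :=
      tendsto_nhds_unique (tendsto_atTop_iSup fun N M hNM => ENNReal.ofReal_le_ofReal (hXmono hNM))
        ((ENNReal.continuous_ofReal.tendsto L).comp hXNl)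
    rw [hsup, ENNReal.toReal_ofReal hL0]
  rw [hlin, setIntegral_congr_set Ioo_ae_eq_Ioc, hL]
  field_simp
  ring

/-- **Energy equality between two times**: for a.e. `t₁ ≤ t₂` in `(0,T)`,
`‖θ(t₂)‖²_{L²} + 2κ ∫_{t₁}^{t₂} ‖∇θ‖²_a = ‖θ(t₁)‖²_{L²} + 2 ∫_{t₁}^{t₂} ∫ s θ` — the energy
dissipated on a time window equals the energy drop plus the work of the source on that window
(Bonicatto–Ciampa–Crippa 2024, Thm. 3.3 (3.4), Remark 3.4; DEIJ 2022, (1.2)–(1.3)); obtained by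
subtracting `energy_eq` at `t₁` from `energy_eq` at `t₂`.
[cite: BonicattoCiampaCrippa2023, Thm. 3.3, (3.4) and Remark 3.4] -/
theorem energy_eq_sub (h : IsWeakScalarTransportDiagForcedOn T a κ u s θ₀ θ)
    (hκ : 0 < κ) (ha : ∀ i, 0 < a i) (hθ₀ : MemLp θ₀ 2 volume)
    (hu : MemLp (stLift u) ⊤ (volume.restrict (Ioo 0 T ×ˢ univ)))
    (hs : ∫⁻ t in Ioo 0 T, (∫⁻ x, ‖s t x‖ₑ ^ 2) ^ (1 / 2 : ℝ) < ⊤) :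
    ∀ᵐ t₁ ∂(volume.restrict (Ioo 0 T)), ∀ᵐ t₂ ∂(volume.restrict (Ioo 0 T)), t₁ ≤ t₂ →
      (∫ x, θ t₂ x ^ 2) + 2 * κ * (∫⁻ τ in Ioo t₁ t₂, Torus.eScalarGradNormSqDiag a (θ τ)).toReal =
        (∫ x, θ t₁ x ^ 2) + 2 * ∫ τ in Ioo t₁ t₂, ∫ x, s τ x * θ τ x := by
  have hE := h.energy_eq hκ ha hθ₀ hu hs
  have hfin := h.lintegral_eScalarGradNormSqDiag_lt_top hκ ha hθ₀ hu hs
  have hsI := h.integrableOn_integral_source_mul hs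
  filter_upwards [hE, ae_restrict_mem measurableSet_Ioo] with t₁ ht₁ ht₁T
  filter_upwards [hE, ae_restrict_mem measurableSet_Ioo] with t₂ ht₂ ht₂T h12
  have hdisj : Disjoint (Ioo 0 t₁) (Ico t₁ t₂) :=
    (Iio_disjoint_Ici le_rfl).mono Ioo_subset_Iio_self Ico_subset_Ici_self
  have hunion : Ioo 0 t₁ ∪ Ico t₁ t₂ = Ioo 0 t₂ := Ioo_union_Ico_eq_Ioo ht₁T.1 h12
  have hsub₂ : Ioo 0 t₂ ⊆ Ioo 0 T := Ioo_subset_Ioo_right ht₂T.2.le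
  -- splitting the dissipation
  have hL : ∫⁻ τ in Ioo 0 t₂, Torus.eScalarGradNormSqDiag a (θ τ) =
      (∫⁻ τ in Ioo 0 t₁, Torus.eScalarGradNormSqDiag a (θ τ)) +
        ∫⁻ τ in Ioo t₁ t₂, Torus.eScalarGradNormSqDiag a (θ τ) := by
    rw [← hunion, lintegral_union measurableSet_Ico hdisj,
      setLIntegral_congr (Ioo_ae_eq_Ico : Ioo t₁ t₂ =ᵐ[volume] Ico t₁ t₂)]
  have hL₂ : ∫⁻ τ in Ioo 0 t₂, Torus.eScalarGradNormSqDiag a (θ τ) ≠ ⊤ :=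
    ((lintegral_mono_set hsub₂).trans_lt hfin).ne
  have hL₁ : ∫⁻ τ in Ioo 0 t₁, Torus.eScalarGradNormSqDiag a (θ τ) ≠ ⊤ :=
    ne_top_of_le_ne_top hL₂ (by rw [hL]; exact le_self_add)
  have hL₁₂ : ∫⁻ τ in Ioo t₁ t₂, Torus.eScalarGradNormSqDiag a (θ τ) ≠ ⊤ :=
    ne_top_of_le_ne_top hL₂ (by rw [hL]; exact le_add_self)
  -- splitting the source work
  have hI : ∫ τ in Ioo 0 t₂, ∫ x, s τ x * θ τ x =
      (∫ τ in Ioo 0 t₁, ∫ x, s τ x * θ τ x) + ∫ τ in Ioo t₁ t₂, ∫ x, s τ x * θ τ x := by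
    rw [← hunion, setIntegral_union hdisj measurableSet_Ico
      (hsI.mono_set (Ioo_subset_Ioo_right ht₁T.2.le))
      (hsI.mono_set ((Ico_subset_Ico_right le_rfl).trans fun τ hτ => ⟨ht₁T.1.trans_le hτ.1, hτ.2.trans ht₂T.2⟩)),
      setIntegral_congr_set (Ioo_ae_eq_Ico : Ioo t₁ t₂ =ᵐ[volume] Ico t₁ t₂)]
  rw [hL, ENNReal.toReal_add hL₁ hL₁₂, hI] at ht₂
  linarith

/-! ## Measurability and the real form of the `A`-dissipation -/

/-- The `A`-dissipation `τ ↦ ‖∇θ(τ)‖²_a` of a weak solution is a.e.-measurable on `(0,T)` (a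
countable supremum of finite sums of squared pairings). [cite: Grafakos2014, Prop. 3.2.7 (3)] -/
theorem aemeasurable_eScalarGradNormSqDiag (h : IsWeakScalarTransportDiagForcedOn T a κ u s θ₀ θ)
    (ha : ∀ i, 0 ≤ a i) :
    AEMeasurable (fun τ => Torus.eScalarGradNormSqDiag a (θ τ)) (volume.restrict (Ioo 0 T)) := by
  have hF : ∀ (N : ℕ) (τ : ℝ), ∑ k ∈ freqBall N, ENNReal.ofReal (4 * Real.pi ^ 2) *
      (ENNReal.ofReal (Torus.diagSymbol a k) * ‖mFourierCoeff (fun x => (θ τ x : ℂ)) k‖ₑ ^ 2) =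
      ENNReal.ofReal (4 * Real.pi ^ 2 * ∑ k ∈ freqBall N,
        Torus.diagSymbol a k * ‖mFourierCoeff (fun x => (θ τ x : ℂ)) k‖ ^ 2) :=
    fun N τ => Torus.sum_freqBall_diag_eq_ofReal ha (θ τ) N
  have e : (fun τ => Torus.eScalarGradNormSqDiag a (θ τ)) = fun τ => ⨆ N : ℕ,
      ENNReal.ofReal (4 * Real.pi ^ 2 * ∑ k ∈ freqBall N,
        Torus.diagSymbol a k * ‖mFourierCoeff (fun x => (θ τ x : ℂ)) k‖ ^ 2) := by
    funext τ
    rw [← Torus.iSup_sum_freqBall_diag a (θ τ)]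
    exact iSup_congr fun N => hF N τ
  rw [e]
  exact AEMeasurable.iSup fun N =>
    (h.integrableOn_galerkin_diss N).aestronglyMeasurable.aemeasurable.ennreal_ofReal

/-- **`L²_t H¹_x` in real form**: the real `A`-dissipation `τ ↦ (‖∇θ(τ)‖²_a).toReal` is integrable
on `(0,T)`, and its integral over `(0,t)`, `t ≤ T`, is `(∫⁻_{(0,t)} ‖∇θ‖²_a).toReal`.
[cite: BonicattoCiampaCrippa2023, Thm. 3.3] -/
theorem integrableOn_toReal_eScalarGradNormSqDiag (h : IsWeakScalarTransportDiagForcedOn T a κ u s θ₀ θ)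
    (hκ : 0 < κ) (ha : ∀ i, 0 < a i) (hθ₀ : MemLp θ₀ 2 volume)
    (hu : MemLp (stLift u) ⊤ (volume.restrict (Ioo 0 T ×ˢ univ)))
    (hs : ∫⁻ t in Ioo 0 T, (∫⁻ x, ‖s t x‖ₑ ^ 2) ^ (1 / 2 : ℝ) < ⊤) :
    IntegrableOn (fun τ => (Torus.eScalarGradNormSqDiag a (θ τ)).toReal) (Ioo 0 T) volume ∧
      ∀ t, t ≤ T → ∫ τ in Ioo 0 t, (Torus.eScalarGradNormSqDiag a (θ τ)).toReal =
        (∫⁻ τ in Ioo 0 t, Torus.eScalarGradNormSqDiag a (θ τ)).toReal := by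
  have hm := h.aemeasurable_eScalarGradNormSqDiag fun i => (ha i).le
  have hfin := h.lintegral_eScalarGradNormSqDiag_lt_top hκ ha hθ₀ hu hs
  refine ⟨integrable_toReal_of_lintegral_ne_top hm hfin.ne, fun t ht => ?_⟩
  have hsub : Ioo 0 t ⊆ Ioo 0 T := Ioo_subset_Ioo_right ht
  have hm' : AEMeasurable (fun τ => Torus.eScalarGradNormSqDiag a (θ τ)) (volume.restrict (Ioo 0 t)) :=
    hm.mono_measure (Measure.restrict_mono hsub le_rfl)
  refine integral_toReal hm' (ae_lt_top' hm' ?_)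
  exact ((lintegral_mono_set hsub).trans_lt hfin).ne

/-- **Dissipation is bounded by the initial energy plus the source work**:
`2κ ∫₀ᵀ ‖∇θ‖²_a ≤ ‖θ₀‖²_{L²} + 2 ∫₀ᵀ |∫ s θ|` (the energy equality at a.e. `t`, `‖θ(t)‖² ≥ 0`,
and `t ↑ T`). [cite: BonicattoCiampaCrippa2023, Thm. 3.3, (3.4)] -/
theorem two_mul_dissipation_le (h : IsWeakScalarTransportDiagForcedOn T a κ u s θ₀ θ)
    (hκ : 0 < κ) (ha : ∀ i, 0 < a i) (hθ₀ : MemLp θ₀ 2 volume)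
    (hu : MemLp (stLift u) ⊤ (volume.restrict (Ioo 0 T ×ˢ univ)))
    (hs : ∫⁻ t in Ioo 0 T, (∫⁻ x, ‖s t x‖ₑ ^ 2) ^ (1 / 2 : ℝ) < ⊤) :
    2 * κ * (∫⁻ τ in Ioo 0 T, Torus.eScalarGradNormSqDiag a (θ τ)).toReal ≤
      (∫ x, θ₀ x ^ 2) + 2 * ∫ τ in Ioo 0 T, |∫ x, s τ x * θ τ x| := by
  obtain ⟨hg, hgt⟩ := h.integrableOn_toReal_eScalarGradNormSqDiag hκ ha hθ₀ hu hs
  rcases le_or_gt T 0 with hT | hT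
  · rw [Ioo_eq_empty_of_le hT, Measure.restrict_empty, lintegral_zero_measure, integral_zero_measure]
    simpa using integral_nonneg fun x => sq_nonneg (θ₀ x)
  have hsI := h.integrableOn_integral_source_mul hs
  -- the bound at a.e. `t`, for `∫_{(0,t]} g`
  have hae : ∀ᵐ t ∂(volume.restrict (Ioo 0 T)),
      ∫ τ in Ioc 0 t, 2 * κ * (Torus.eScalarGradNormSqDiag a (θ τ)).toReal ≤
        (∫ x, θ₀ x ^ 2) + 2 * ∫ τ in Ioo 0 T, |∫ x, s τ x * θ τ x| := by
    filter_upwards [h.energy_eq hκ ha hθ₀ hu hs, ae_restrict_mem measurableSet_Ioo] with t ht htT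
    have hsub : Ioc 0 t ⊆ Ioo 0 T := Ioc_subset_Ioo_right htT.2
    rw [integral_const_mul, setIntegral_congr_set Ioo_ae_eq_Ioc.symm, hgt t htT.2.le]
    have hsIa : IntegrableOn (fun τ => |∫ x, s τ x * θ τ x|) (Ioo 0 T) volume := hsI.abs
    have h1 : ∫ τ in Ioo 0 t, ∫ x, s τ x * θ τ x ≤ ∫ τ in Ioo 0 T, |∫ x, s τ x * θ τ x| := by
      rw [setIntegral_congr_set Ioo_ae_eq_Ioc]
      calc ∫ τ in Ioc 0 t, ∫ x, s τ x * θ τ x ≤ ∫ τ in Ioc 0 t, |∫ x, s τ x * θ τ x| :=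
            integral_mono_ae (hsI.mono_set hsub) (hsIa.mono_set hsub) (Eventually.of_forall fun τ => le_abs_self _)
        _ ≤ ∫ τ in Ioo 0 T, |∫ x, s τ x * θ τ x| :=
            setIntegral_mono_set hsIa (Eventually.of_forall fun τ => abs_nonneg _) hsub.eventuallyLE
    have hθt0 : 0 ≤ ∫ x, θ t x ^ 2 := integral_nonneg fun x => sq_nonneg _
    nlinarith [hθt0, ht, h1]
  have hfull := setIntegral_Ioo_le_of_ae_setIntegral_Ioc_le hT (hg.const_mul (2 * κ)) hae
  rwa [integral_const_mul, hgt T le_rfl] at hfull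

/-! ## The homogeneous diagonal class -/

omit [DecidableEq d] in
/-- `∫⁻ ‖f‖ₑ² = ofReal (∫ f²)` for a real `f ∈ L²(T^d)`. [folklore] -/
private theorem lintegral_enorm_sq_eq_ofReal_sq'' {f : UnitAddTorus d → ℝ} (hf : MemLp f 2 volume) :
    ∫⁻ x, ‖f x‖ₑ ^ 2 = ENNReal.ofReal (∫ x, f x ^ 2) := by
  rw [ofReal_integral_eq_lintegral_ofReal hf.integrable_sq (ae_of_all _ fun x => sq_nonneg _)]
  refine lintegral_congr_ae (ae_of_all _ fun x => ?_)
  show ‖f x‖ₑ ^ 2 = ENNReal.ofReal (f x ^ 2)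
  rw [← ofReal_norm, ← ENNReal.ofReal_pow (norm_nonneg _), Real.norm_eq_abs, sq_abs]

omit [DecidableEq d] in
/-- A zero source is in `L¹_t L²_x`. [folklore] -/
private theorem lintegral_source_zero (T : ℝ) :
    ∫⁻ t in Ioo 0 T, (∫⁻ x : UnitAddTorus d, ‖(0 : ℝ → UnitAddTorus d → ℝ) t x‖ₑ ^ 2) ^ (1 / 2 : ℝ) < ⊤ := by
  simp

/-- **Energy equality for the homogeneous diagonal class** (`s = 0`), `ℝ≥0∞` form: for `κ > 0`,
`aᵢ > 0`, `θ₀ ∈ L²` and an `L^∞` drift, every weak solution of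
`∂ₜθ + u·∇θ = κ ∑ᵢ aᵢ ∂ᵢ∂ᵢθ` (`Torus.IsWeakScalarTransportDiagOn`) satisfies, for a.e. `t ∈ (0,T)`,
`‖θ(t)‖²_{L²} + 2κ ∫₀ᵗ ‖∇θ‖²_a = ‖θ₀‖²_{L²}` — the EQUALITY form of the pointwise energy balance
(Bonicatto–Ciampa–Crippa 2024, Thm. 3.3 (3.4), Remark 3.4; DEIJ 2022, (1.2)), for the diffusion of
a rectangular flat torus in unit-torus coordinates (Hess-Childs–Rowan 2025, App. A).
[cite: BonicattoCiampaCrippa2023, Thm. 3.3, (3.4) and Remark 3.4] -/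
theorem _root_.Literature.Analysis.FluidPDE.Torus.IsWeakScalarTransportDiagOn.lintegral_sq_add_eq
    {θ₀ : UnitAddTorus d → ℝ} {θ : ℝ → UnitAddTorus d → ℝ}
    (h : IsWeakScalarTransportDiagOn T a κ u θ₀ θ) (hκ : 0 < κ) (ha : ∀ i, 0 < a i)
    (hθ₀ : MemLp θ₀ 2 volume) (hu : MemLp (stLift u) ⊤ (volume.restrict (Ioo 0 T ×ˢ univ))) :
    ∀ᵐ t ∂(volume.restrict (Ioo 0 T)),
      (∫⁻ x, ‖θ t x‖ₑ ^ 2) + 2 * ENNReal.ofReal κ * ∫⁻ τ in Ioo 0 t, Torus.eScalarGradNormSqDiag a (θ τ) =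
        ∫⁻ x, ‖θ₀ x‖ₑ ^ 2 := by
  have h' : IsWeakScalarTransportDiagForcedOn T a κ u 0 θ₀ θ := isWeakScalarTransportDiagForcedOn_zero_iff.2 h
  have hs := lintegral_source_zero (d := d) T
  have hfin := h'.lintegral_eScalarGradNormSqDiag_lt_top hκ ha hθ₀ hu hs
  filter_upwards [h'.energy_eq hκ ha hθ₀ hu hs, h'.ae_memLp_two, ae_restrict_mem measurableSet_Ioo]
    with t ht hm htT
  have hXt : ∫⁻ τ in Ioo 0 t, Torus.eScalarGradNormSqDiag a (θ τ) ≠ ⊤ :=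
    ((lintegral_mono_set (Ioo_subset_Ioo_right htT.2.le)).trans_lt hfin).ne
  simp only [Pi.zero_apply, zero_mul, integral_zero, mul_zero, add_zero] at ht
  rw [lintegral_enorm_sq_eq_ofReal_sq'' hm, lintegral_enorm_sq_eq_ofReal_sq'' hθ₀, ← ht,
    ENNReal.ofReal_add (integral_nonneg fun x => sq_nonneg _) (by positivity)]
  congr 1
  rw [ENNReal.ofReal_mul (by positivity : (0 : ℝ) ≤ 2 * κ), ENNReal.ofReal_toReal hXt,
    ENNReal.ofReal_mul zero_le_two, ENNReal.ofReal_ofNat]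

/-- **Energy inequality over the whole interval for the homogeneous diagonal class**:
`2κ ∫₀ᵀ ‖∇θ‖²_a ≤ ‖θ₀‖²_{L²}` (`ℝ≥0∞`; the twin of `Torus.IsWeakScalarTransportOn.energy_ineq` for
`κ ∑ᵢ aᵢ ∂ᵢ∂ᵢ`, DEIJ 2022, (1.2)). [cite: DEIJ2022, (1.2)] -/
theorem _root_.Literature.Analysis.FluidPDE.Torus.IsWeakScalarTransportDiagOn.energy_ineq
    {θ₀ : UnitAddTorus d → ℝ} {θ : ℝ → UnitAddTorus d → ℝ}
    (h : IsWeakScalarTransportDiagOn T a κ u θ₀ θ) (hκ : 0 < κ) (ha : ∀ i, 0 < a i)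
    (hθ₀ : MemLp θ₀ 2 volume) (hu : MemLp (stLift u) ⊤ (volume.restrict (Ioo 0 T ×ˢ univ))) :
    2 * ENNReal.ofReal κ * ∫⁻ τ in Ioo 0 T, Torus.eScalarGradNormSqDiag a (θ τ) ≤ ∫⁻ x, ‖θ₀ x‖ₑ ^ 2 := by
  have h' : IsWeakScalarTransportDiagForcedOn T a κ u 0 θ₀ θ := isWeakScalarTransportDiagForcedOn_zero_iff.2 h
  have hs := lintegral_source_zero (d := d) T
  have hfin := h'.lintegral_eScalarGradNormSqDiag_lt_top hκ ha hθ₀ hu hs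
  have hb := h'.two_mul_dissipation_le hκ ha hθ₀ hu hs
  simp only [Pi.zero_apply, zero_mul, integral_zero, abs_zero, mul_zero, add_zero] at hb
  rw [lintegral_enorm_sq_eq_ofReal_sq'' hθ₀, ← ENNReal.ofReal_toReal hfin.ne]
  have e : ENNReal.ofReal (2 * κ * (∫⁻ τ in Ioo 0 T, Torus.eScalarGradNormSqDiag a (θ τ)).toReal) =
      2 * ENNReal.ofReal κ * ENNReal.ofReal (∫⁻ τ in Ioo 0 T, Torus.eScalarGradNormSqDiag a (θ τ)).toReal := by
    rw [ENNReal.ofReal_mul (by positivity : (0 : ℝ) ≤ 2 * κ), ENNReal.ofReal_mul zero_le_two, ENNReal.ofReal_ofNat]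
  rw [← e]
  exact ENNReal.ofReal_le_ofReal hb

/-! ## The isotropic corollaries (`a ≡ 1`) -/

/-- **Energy equality for the forced isotropic passive scalar with bounded drift**: for `κ > 0`,
`θ₀ ∈ L²`, `u ∈ L^∞` and `∫₀ᵀ ‖s‖_{L²} < ∞`, every weak solution of `∂ₜθ + u·∇θ = κΔθ + s`
(`Torus.IsWeakScalarTransportForcedOn`) satisfies, for a.e. `t ∈ (0,T)`,
`‖θ(t)‖² + 2κ ∫₀ᵗ ‖∇θ‖² = ‖θ₀‖² + 2∫₀ᵗ∫ s θ` with the spectral gradient norm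
`Torus.eScalarGradNormSq` (Bonicatto–Ciampa–Crippa 2024, Thm. 3.3 (3.4), Rem. 3.4, with a source;
DEIJ 2022, (1.1)–(1.2)) — the case `a ≡ 1` of `IsWeakScalarTransportDiagForcedOn.energy_eq`
(`Torus.isWeakScalarTransportDiagForcedOn_one_iff`, `Torus.eScalarGradNormSqDiag_one`).
[cite: BonicattoCiampaCrippa2023, Thm. 3.3, (3.4) and Remark 3.4] -/
theorem _root_.Literature.Analysis.FluidPDE.Torus.IsWeakScalarTransportForcedOn.energy_eq
    {θ₀ : UnitAddTorus d → ℝ} {θ : ℝ → UnitAddTorus d → ℝ}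
    (h : IsWeakScalarTransportForcedOn T κ u s θ₀ θ) (hκ : 0 < κ) (hθ₀ : MemLp θ₀ 2 volume)
    (hu : MemLp (stLift u) ⊤ (volume.restrict (Ioo 0 T ×ˢ univ)))
    (hs : ∫⁻ t in Ioo 0 T, (∫⁻ x, ‖s t x‖ₑ ^ 2) ^ (1 / 2 : ℝ) < ⊤) :
    ∀ᵐ t ∂(volume.restrict (Ioo 0 T)),
      (∫ x, θ t x ^ 2) + 2 * κ * (∫⁻ τ in Ioo 0 t, Torus.eScalarGradNormSq (θ τ)).toReal =
        (∫ x, θ₀ x ^ 2) + 2 * ∫ τ in Ioo 0 t, ∫ x, s τ x * θ τ x := by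
  have h' : IsWeakScalarTransportDiagForcedOn T (fun _ : d => (1 : ℝ)) κ u s θ₀ θ :=
    isWeakScalarTransportDiagForcedOn_one_iff.2 h
  filter_upwards [h'.energy_eq hκ (fun _ => one_pos) hθ₀ hu hs] with t ht
  simpa only [Torus.eScalarGradNormSqDiag_one] using ht

/-- **`L²_t H¹_x` for the forced isotropic class with bounded drift**:
`∫₀ᵀ ‖∇θ‖²_{L²} < ∞` for every weak solution (Bonicatto–Ciampa–Crippa 2024, Thm. 3.3:
parabolicity). [cite: BonicattoCiampaCrippa2023, Thm. 3.3] -/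
theorem _root_.Literature.Analysis.FluidPDE.Torus.IsWeakScalarTransportForcedOn.lintegral_eScalarGradNormSq_lt_top
    {θ₀ : UnitAddTorus d → ℝ} {θ : ℝ → UnitAddTorus d → ℝ}
    (h : IsWeakScalarTransportForcedOn T κ u s θ₀ θ) (hκ : 0 < κ) (hθ₀ : MemLp θ₀ 2 volume)
    (hu : MemLp (stLift u) ⊤ (volume.restrict (Ioo 0 T ×ˢ univ)))
    (hs : ∫⁻ t in Ioo 0 T, (∫⁻ x, ‖s t x‖ₑ ^ 2) ^ (1 / 2 : ℝ) < ⊤) :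
    ∫⁻ τ in Ioo 0 T, Torus.eScalarGradNormSq (θ τ) < ⊤ := by
  have h' : IsWeakScalarTransportDiagForcedOn T (fun _ : d => (1 : ℝ)) κ u s θ₀ θ :=
    isWeakScalarTransportDiagForcedOn_one_iff.2 h
  simpa only [Torus.eScalarGradNormSqDiag_one] using
    h'.lintegral_eScalarGradNormSqDiag_lt_top hκ (fun _ => one_pos) hθ₀ hu hs

/-- **Energy EQUALITY for the homogeneous isotropic passive scalar with bounded drift**, the
`=`-form of `Torus.IsWeakScalarTransportOn.lintegral_sq_add_le_holds`: for a.e. `t ∈ (0,T)`,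
`‖θ(t)‖²_{L²} + 2κ ∫₀ᵗ ‖∇θ‖² = ‖θ₀‖²_{L²}` in `ℝ≥0∞` with `Torus.eScalarDissipation`
(Bonicatto–Ciampa–Crippa 2024, Thm. 3.3 (3.4), Remark 3.4: the balance holds as an equality).
[cite: BonicattoCiampaCrippa2023, Thm. 3.3, (3.4) and Remark 3.4] -/
theorem _root_.Literature.Analysis.FluidPDE.Torus.IsWeakScalarTransportOn.lintegral_sq_add_eq
    {θ₀ : UnitAddTorus d → ℝ} {θ : ℝ → UnitAddTorus d → ℝ}
    (h : IsWeakScalarTransportOn T κ u θ₀ θ) (hκ : 0 < κ) (hθ₀ : MemLp θ₀ 2 volume)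
    (hu : MemLp (stLift u) ⊤ (volume.restrict (Ioo 0 T ×ˢ univ))) :
    ∀ᵐ t ∂(volume.restrict (Ioo 0 T)),
      (∫⁻ x, ‖θ t x‖ₑ ^ 2) + 2 * eScalarDissipation κ θ 0 t = ∫⁻ x, ‖θ₀ x‖ₑ ^ 2 := by
  have h' : IsWeakScalarTransportDiagOn T (fun _ : d => (1 : ℝ)) κ u θ₀ θ := isWeakScalarTransportDiagOn_one_iff.2 h
  filter_upwards [h'.lintegral_sq_add_eq hκ (fun _ => one_pos) hθ₀ hu] with t ht
  simpa only [Torus.eScalarGradNormSqDiag_one, eScalarDissipation, mul_assoc] using ht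

end IsWeakScalarTransportDiagForcedOn

end Torus

end Literature.Analysis.FluidPDE

end
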